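import Literature.NumberTheory.Automorphic.UnitaryThreeUnipotentConjugacy   -- ★ p08: `B₀`, `mem_unitaryGroupOfForm_antidiagonal_iff`, `B₀_three_apply`, transitivity on isotropic vectors
import HarnessLib

/-!
# Eigenvectors of a unitary isometry: `σλ·λ ≠ 1 ⇒` isotropic, `σλ·μ ≠ 1 ⇒` orthogonal; fixed isotropic lines of a residually semisimple element
# (Wilson, *The Finite Simple Groups*, §3.6.2; Rogawski 1990, §3.4–§3.6)

Topic `NumberTheory/Automorphic`; namespace `Literature.NumberTheory.Automorphic.UnitaryGroup`.  THEOREMS ONLY (no definition, no instance, no notation, no named fact, no `sorry`).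
Road «S3-tree» of cell `pub/hodgecm-mathlib` (crux H413 = `stmt-HodgeConjecture-24833`), T2-E′ «LOCAL FIXED-SPHERE DICTIONARY» (architect A-63; holder F0P2-p06 (g10)): the SEMISIMPLE
rows «regular semisimple ⇒ eigenline count; one repeated eigenvalue on a non-degenerate eigenplane ⇒ the plane; scalar ⇒ all» in their finite-group form, ★ p08 currency
(`unitaryGroupOfForm σ J₀`, `J₀ = (StdForm.antidiagonal N).over K`, `B₀ σ N`), any field `K` with a ring endomorphism `σ` (involution where stated); organ by F0P3-p03 (g13).
HONEST LABEL: HC_CM is proved only modulo the printed citations (the 2 remaining named inputs hLiu418, h413) until rung 0 closes; elementary sesquilinear algebra only.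

THE PRINT. [Wilson2009, §3.6.2 p. 68]: «if `e_i ↦ λ e_i` then `f_i ↦ μ f_i`, where `μ = λ̄⁻¹`» (eigenvalues of a unitary isometry pair off under `λ ↦ (σλ)⁻¹`; an eigenvalue not paired
with itself has an ISOTROPIC eigenvector); [Rogawski1990, §3.4–§3.6 pp. 27–30] (the tori of `U(3)`: `(E¹)³` — three anisotropic eigenlines; `E^× × E¹` — a hyperbolic pair of
eigenlines and an anisotropic one; the elliptic `(E_L)¹ × E¹`).  Typed: for `s ∈ U(σ, J₀)` and eigenvectors `s v = λ v`, `s w = μ w`: `B₀ v w · (σλ·μ − 1) = 0`; hence `σλ·λ ≠ 1 ⇒ v`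
isotropic, `σλ·μ ≠ 1 ⇒ v ⊥ w`; an eigenvector whose eigenvalue satisfies `σλ·λ = 1` and differs from the two other eigenvalues of an eigenbasis is ANISOTROPIC (it is orthogonal to
the rest of the basis and `B₀` is non-degenerate); two independent eigenvectors with the same eigenvalue force `σλ·λ = 1`.

* §1 `B₀_eigenvector_mul` (`B₀ v w = σλ·μ·B₀ v w`), **`B₀_self_eq_zero_of_eigenvector`**, **`B₀_eq_zero_of_eigenvectors`** (any `N`).
* §2 (`N = 3`) `eq_zero_of_B₀_eq_zero_basis` (non-degeneracy against a basis), **`B₀_self_ne_zero_of_eigenbasis`** (the `σλ·λ = 1` eigenline of a split regular semisimple element is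
  anisotropic), **`norm_eq_one_of_eigenplane`** (a repeated eigenvalue has `σλ·λ = 1`), `smul_mem_of_fixed_line` (fixed line = eigenvector, bookkeeping).

## References
* [Wilson2009] R. A. Wilson, *The Finite Simple Groups*, GTM 251 (2009): §3.6.2 p. 68.
* [Rogawski1990] J. D. Rogawski, *Automorphic Representations of Unitary Groups in Three Variables* (1990): §3.4–§3.6 pp. 27–30 (tori and their eigenframes).
-/

set_option autoImplicit false

open Matrix

namespace Literature.NumberTheory.Automorphic.UnitaryGroup

open Literature.NumberTheory.Automorphic.HermitianLattice

variable {K : Type*} [Field K] (σ : K →+* K)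

/-! ## §1 Eigenvectors of an isometry (any `N`) -/

/-- `B₀ v w = σλ·μ·B₀ v w` for eigenvectors `s v = λ v`, `s w = μ w` of an isometry `s`. [cite: Wilson2009, §3.6.2 p. 68] -/
theorem B₀_eigenvector_mul {N : ℕ} {s : GL (Fin N) K} (hs : s ∈ unitaryGroupOfForm σ ((StdForm.antidiagonal N).over K))
    {v w : Fin N → K} {c d : K} (hv : (s : Matrix (Fin N) (Fin N) K) *ᵥ v = c • v) (hw : (s : Matrix (Fin N) (Fin N) K) *ᵥ w = d • w) :
    B₀ σ N v w = σ c * d * B₀ σ N v w := by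
  rw [mem_unitaryGroupOfForm_antidiagonal_iff] at hs
  have h := hs v w
  rw [hv, hw, LinearMap.map_smulₛₗ₂, map_smul, smul_eq_mul, smul_eq_mul] at h
  linear_combination -h

/-- **An eigenvector with `σλ·λ ≠ 1` is isotropic.** [cite: Wilson2009, §3.6.2 p. 68] -/
theorem B₀_self_eq_zero_of_eigenvector {N : ℕ} {s : GL (Fin N) K} (hs : s ∈ unitaryGroupOfForm σ ((StdForm.antidiagonal N).over K))
    {v : Fin N → K} {c : K} (hv : (s : Matrix (Fin N) (Fin N) K) *ᵥ v = c • v) (hc : σ c * c ≠ 1) : B₀ σ N v v = 0 := by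
  have h := B₀_eigenvector_mul σ hs hv hv
  have : (σ c * c - 1) * B₀ σ N v v = 0 := by linear_combination -h
  rcases mul_eq_zero.1 this with h1 | h1
  · exact absurd (sub_eq_zero.1 h1) hc
  · exact h1

/-- **Eigenvectors with `σλ·μ ≠ 1` are orthogonal.** [cite: Wilson2009, §3.6.2 p. 68] -/
theorem B₀_eq_zero_of_eigenvectors {N : ℕ} {s : GL (Fin N) K} (hs : s ∈ unitaryGroupOfForm σ ((StdForm.antidiagonal N).over K))
    {v w : Fin N → K} {c d : K} (hv : (s : Matrix (Fin N) (Fin N) K) *ᵥ v = c • v) (hw : (s : Matrix (Fin N) (Fin N) K) *ᵥ w = d • w) (hcd : σ c * d ≠ 1) :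
    B₀ σ N v w = 0 := by
  have h := B₀_eigenvector_mul σ hs hv hw
  have : (σ c * d - 1) * B₀ σ N v w = 0 := by linear_combination -h
  rcases mul_eq_zero.1 this with h1 | h1
  · exact absurd (sub_eq_zero.1 h1) hcd
  · exact h1

/-- A vector spanning an `s`-fixed line is an eigenvector (bookkeeping form of «fixed line = eigenline»). [cite: Rogawski1990, §3.4 p. 27] -/
theorem exists_eigenvalue_of_fixed_line {N : ℕ} {s : GL (Fin N) K} {v : Fin N → K}
    (h : ∃ c : K, (s : Matrix (Fin N) (Fin N) K) *ᵥ v = c • v) : ∃ c : K, ∀ x ∈ Submodule.span K {v}, (s : Matrix (Fin N) (Fin N) K) *ᵥ x = c • x := by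
  obtain ⟨c, hc⟩ := h
  refine ⟨c, fun x hx => ?_⟩
  obtain ⟨a, rfl⟩ := Submodule.mem_span_singleton.1 hx
  rw [Matrix.mulVec_smul, hc, smul_comm]

/-! ## §2 Three variables: anisotropic eigenlines, repeated eigenvalues -/

/-- Non-degeneracy of `B₀` on `K³` against a basis: if `B₀ v b_i = 0` for a spanning family `b`, then `v = 0`. [cite: Rogawski1990, §3.4 p. 27] -/
theorem eq_zero_of_B₀_eq_zero_of_span (hσ : Function.Injective σ) {ι : Type*} {b : ι → Fin 3 → K} (hb : Submodule.span K (Set.range b) = ⊤)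
    {v : Fin 3 → K} (h : ∀ i, B₀ σ 3 v (b i) = 0) : v = 0 := by
  have hall : ∀ x : Fin 3 → K, B₀ σ 3 v x = 0 := by
    intro x
    have hx : x ∈ Submodule.span K (Set.range b) := by rw [hb]; exact Submodule.mem_top
    refine Submodule.span_induction (fun y hy => ?_) (by simp) (fun y z _ _ hy hz => by rw [map_add, hy, hz, add_zero])
      (fun a y _ hy => by rw [map_smul, hy, smul_zero]) hx
    obtain ⟨i, rfl⟩ := hy
    exact h i
  funext j
  have := hall (Pi.single (Fin.rev j) 1)
  rw [B₀_single_right, Fin.rev_rev] at this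
  exact hσ (by rw [this, Pi.zero_apply, map_zero])

/-- **The `σλ·λ = 1` eigenline of a split regular semisimple isometry is anisotropic**: if `b₀, b₁, b₂` span `K³`, `s b_i = λ_i b_i` with `σλ₀·λ₀ = 1` and `λ₁ ≠ λ₀`, `λ₂ ≠ λ₀`, then
`B₀ b₀ b₀ ≠ 0` (as `b₀ ⊥ b₁, b₂` by §1 and `B₀` is non-degenerate) — so such an eigenline is NOT an isotropic fixed point; the count of fixed isotropic lines of `s` is `#{i : σλ_i·λ_i ≠ 1}`.
[cite: Rogawski1990, §3.6 p. 30] [cite: Wilson2009, §3.6.2 p. 68] -/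
theorem B₀_self_ne_zero_of_eigenbasis (hσi : Function.Injective σ) {s : GL (Fin 3) K} (hs : s ∈ unitaryGroupOfForm σ ((StdForm.antidiagonal 3).over K))
    {b : Fin 3 → Fin 3 → K} (hb : Submodule.span K (Set.range b) = ⊤) {lam : Fin 3 → K}
    (heig : ∀ i, (s : Matrix (Fin 3) (Fin 3) K) *ᵥ b i = lam i • b i) (h0 : σ (lam 0) * lam 0 = 1) (h1 : lam 1 ≠ lam 0) (h2 : lam 2 ≠ lam 0) :
    B₀ σ 3 (b 0) (b 0) ≠ 0 := by
  intro hiso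
  have hl0 : lam 0 ≠ 0 := by intro h; rw [h, mul_zero] at h0; exact zero_ne_one h0
  have hσ0 : σ (lam 0) = (lam 0)⁻¹ := eq_inv_of_mul_eq_one_left h0
  have horth : ∀ j, lam j ≠ lam 0 → B₀ σ 3 (b 0) (b j) = 0 := fun j hj =>
    B₀_eq_zero_of_eigenvectors σ hs (heig 0) (heig j) (by rw [hσ0]; intro h; exact hj ((inv_mul_eq_one₀ hl0).1 h).symm)
  have hb0 : b 0 = 0 := eq_zero_of_B₀_eq_zero_of_span σ hσi hb fun i => by
    fin_cases i
    · exact hiso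
    · exact horth 1 h1
    · exact horth 2 h2
  -- `b 0 = 0` and `b` spans `K³`: then `K³ = span{b 1, b 2}` has dimension `≤ 2`, absurd
  classical
  have hspan : Submodule.span K (Set.range b) ≤ Submodule.span K ((({b 1, b 2} : Finset (Fin 3 → K)) : Set (Fin 3 → K))) := by
    refine Submodule.span_le.2 (Set.range_subset_iff.2 fun i => ?_)
    fin_cases i
    · show b 0 ∈ _; rw [hb0]; exact Submodule.zero_mem _
    · show b 1 ∈ _; exact Submodule.subset_span (by simp)
    · show b 2 ∈ _; exact Submodule.subset_span (by simp)
  have hle : Module.finrank K (Fin 3 → K) ≤ 2 := by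
    have htop : (⊤ : Submodule K (Fin 3 → K)) ≤ Submodule.span K ((({b 1, b 2} : Finset (Fin 3 → K)) : Set (Fin 3 → K))) := hb ▸ hspan
    calc Module.finrank K (Fin 3 → K) = Module.finrank K (⊤ : Submodule K (Fin 3 → K)) := (finrank_top K (Fin 3 → K)).symm
      _ ≤ Module.finrank K (Submodule.span K ((({b 1, b 2} : Finset (Fin 3 → K)) : Set (Fin 3 → K)))) := Submodule.finrank_mono htop
      _ ≤ ({b 1, b 2} : Finset (Fin 3 → K)).card := finrank_span_finset_le_card _
      _ ≤ 2 := Finset.card_le_two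
  rw [Module.finrank_fin_fun] at hle
  omega

/-- **A repeated eigenvalue has norm one**: two linearly independent eigenvectors `v, w` of `s ∈ U(σ, J₀)` (`K³`, `σ` an involution) with the same eigenvalue `λ` force `σλ·λ = 1` —
otherwise `v, w` would be isotropic and orthogonal (§1), i.e. `span{v, w}` a totally isotropic PLANE of the non-degenerate 3-space, impossible (move `v` to `e₀` by ★ transitivity; an
isotropic `w′ ⊥ e₀` lies in `K e₀`). [cite: Rogawski1990, §3.6 p. 30] [cite: Wilson2009, §3.6.2 p. 68] -/
theorem norm_eq_one_of_eigenplane (hσ : ∀ z : K, σ (σ z) = z) {s : GL (Fin 3) K} (hs : s ∈ unitaryGroupOfForm σ ((StdForm.antidiagonal 3).over K))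
    {v w : Fin 3 → K} {c : K} (hv : (s : Matrix (Fin 3) (Fin 3) K) *ᵥ v = c • v) (hw : (s : Matrix (Fin 3) (Fin 3) K) *ᵥ w = c • w)
    (hind : LinearIndependent K ![v, w]) : σ c * c = 1 := by
  by_contra hc
  have hv0 : v ≠ 0 := by simpa using hind.ne_zero 0
  have hviso := B₀_self_eq_zero_of_eigenvector σ hs hv hc
  have hwiso := B₀_self_eq_zero_of_eigenvector σ hs hw hc
  have hvw := B₀_eq_zero_of_eigenvectors σ hs hv hw hc
  -- move `v` to `e₀`
  obtain ⟨g, hg, hge⟩ := exists_mem_unitaryGroupOfForm_mulVec_single_eq σ hσ hv0 hviso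
  have hginv := Subgroup.inv_mem _ hg
  rw [mem_unitaryGroupOfForm_antidiagonal_iff] at hginv
  have hgg' : (g : Matrix (Fin 3) (Fin 3) K) * ((g⁻¹ : GL (Fin 3) K) : Matrix (Fin 3) (Fin 3) K) = 1 := by
    rw [← Units.val_mul, mul_inv_cancel, Units.val_one]
  have hgg : ((g⁻¹ : GL (Fin 3) K) : Matrix (Fin 3) (Fin 3) K) * (g : Matrix (Fin 3) (Fin 3) K) = 1 := by
    rw [← Units.val_mul, inv_mul_cancel, Units.val_one]
  have hv' : ((g⁻¹ : GL (Fin 3) K) : Matrix (Fin 3) (Fin 3) K) *ᵥ v = Pi.single 0 1 := by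
    rw [← hge, Matrix.mulVec_mulVec, hgg, Matrix.one_mulVec]
  obtain ⟨w', hw'⟩ : ∃ w' : Fin 3 → K, ((g⁻¹ : GL (Fin 3) K) : Matrix (Fin 3) (Fin 3) K) *ᵥ w = w' := ⟨_, rfl⟩
  have hw : w = (g : Matrix (Fin 3) (Fin 3) K) *ᵥ w' := by rw [← hw', Matrix.mulVec_mulVec, hgg', Matrix.one_mulVec]
  have h02 : w' 2 = 0 := by
    have := hginv v w
    rw [hv', hw', hvw, B₀_single_left, show Fin.rev (0 : Fin 3) = 2 from by decide] at this
    exact this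
  have h01 : w' 1 = 0 := by
    have := hginv w w
    rw [hw', hwiso, B₀_three_apply, h02, map_zero, zero_mul, mul_zero, add_zero, zero_add] at this
    rcases mul_eq_zero.1 this with h | h
    · rw [← hσ (w' 1), h, map_zero]
    · exact h
  -- so `w = w'₀ • v`, contradicting independence
  have hw_eq : w = w' 0 • v := by
    rw [hw, ← hge, ← Matrix.mulVec_smul]
    congr 1
    funext i
    fin_cases i
    · simp
    · simp [h01]
    · simp [h02]
  have : ¬ LinearIndependent K ![v, w] := by
    rw [LinearIndependent.pair_iff]
    push Not
    exact ⟨w' 0, -1, by rw [hw_eq]; simp, by simp⟩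
  exact this hind

end Literature.NumberTheory.Automorphic.UnitaryGroup
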